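import Literature.Analysis.FluidPDE.FluidComputer.ThresholdLevelTableL
import HarnessLib

/-!
# Kernel run of the re-cut level-table checker, chunks 36 … 39 (steps 900 … 999) (bp3 gen 13)

HONEST FRAMING: low prior, high value-of-information experiment on Tao's machine paradigm; NOT a
claim that NS blows up.

Four kernel evaluations (`decide +kernel`; no `native_decide`, no extra axioms) of the checker
`runSteps` (`ThresholdLevelCheck.lean`) on 25 steps of `ThresholdLevelTableL.stepsT` at a time, from
the entry box `Bc i` towards the next chunk's first level, returning the entry box `Bc (i+1)`
(≈ 30 s of kernel time per chunk; same scheme as `ThresholdLevelTableRun0 … 7`).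
-/

namespace Literature.Analysis.FluidPDE.FluidComputer

namespace ThresholdLevelTableL

open ThresholdLevelTable (GIt RbIt)

set_option maxHeartbeats 10000000 in
set_option maxRecDepth 200000 in
/-- Chunk 36 of the re-cut table run (steps 900 … 924). [folklore] -/
theorem run36 : runSteps 60 12 3 GIt RbIt Bc36 chunk36 11669527126281278 = some Bc37 := by
  decide +kernel

set_option maxHeartbeats 10000000 in
set_option maxRecDepth 200000 in
/-- Chunk 37 of the re-cut table run (steps 925 … 949). [folklore] -/
theorem run37 : runSteps 60 12 3 GIt RbIt Bc37 chunk37 13213204858234400 = some Bc38 := by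
  decide +kernel

set_option maxHeartbeats 10000000 in
set_option maxRecDepth 200000 in
/-- Chunk 38 of the re-cut table run (steps 950 … 974). [folklore] -/
theorem run38 : runSteps 60 12 3 GIt RbIt Bc38 chunk38 14961084604060156 = some Bc39 := by
  decide +kernel

set_option maxHeartbeats 10000000 in
set_option maxRecDepth 200000 in
/-- Chunk 39 of the re-cut table run (steps 975 … 999). [folklore] -/
theorem run39 : runSteps 60 12 3 GIt RbIt Bc39 chunk39 16940178778076964 = some Bc40 := by
  decide +kernel

end ThresholdLevelTableL

end Literature.Analysis.FluidPDE.FluidComputer
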